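import Summits.CriticalPhenomena.PercolationContinuityZ3.Theorems.Transplant.FKConjectureCDefs
import Literature.Combinatorics.Matroid.VectorMatroid
import HarnessLib

/-!
substantive: a SECOND witness against `FK.ConjectureC` (the all-matroid pair-square-cone statement `(ID)_J`, p652189, already REFUTED in the
tree by `FK.not_conjectureC`, file `FKConjectureC/Negative/SpikeCounterexample`, p703849): «S₈⁺ = S₈ with the leg {x₁,y₁} doubled, J = 0,
SR_0(t,x₄) = −96». What this witness adds: `S₈ = Z₄∖y₄` itself satisfies `(ID)_0` (n = 8 census), so MEMBERSHIP OF `K_0` IN THE PAIR-SQUARE CONE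
IS NOT PRESERVED BY PARALLEL EXTENSION — `S₈⁺ = S₈` with both elements of the leg `{x₁,y₁}` doubled `= (S₈ ⊕₂ U_{1,3}) ⊕₂ U_{1,3}`; hence
`𝒯 = {M : (ID)_J ∀ J}` is not closed under parallel extension (2-sum with `U_{1,3}`) for general (binary) matroids — which of the two steps leaves `𝒯`
is open (fk-crit-1 g3, cell INBOX l.8803 / l.8843). Regular / graphic matroids are NOT touched by this witness.

# A second counterexample to `FK.ConjectureC`: the Seymour–Welsh matroid `S₈` with a doubled leg (`S₈⁺`), level `J = 0`

Claimed R42 (8)(c) in the cell INBOX at 2026-08-29T08:56:30Z by fkp-10a gen 359 (NEW CLAIM #7 of the gen: director-frontier g16′s statement/helper slot (b), cell INBOX l.8807 / l.8827), addressed to coordinator fk-4 gen 294 (seated 06:59Z 2026-08-29 by l.8791; R172–R176 in force; ruling R178 requested); lineage row FO-10a-g359s (self-suggested), package g359-s8par, label S8-A.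
Filed for the tree by fkp-10a gen 359 (prover-prim-bschramm-fkp-10a-g359-0) on director-frontier g16's ruling (cell INBOX l.8807 (b): «file ONLY
as an INSTANCE-NAMED negative lemma `Theorems/FKConjectureC/Negative/S8ParCounterexample.lean` … NOT a second `not_conjectureC`»): the
mathematics, the tables and the two `native_decide` evaluations are fk-idea-4 gen 3's `fk-continuity/ideation/prim-bschramm-fk-idea-4/gen3/lean/
FKConjectureCRefutationS8Par.lean` (rc 0 on the farm, 2026-08-29) byte-for-byte; this file renames the conclusion instance-wise
(`not_inPairSquareCone_conjCKernel_S8par_zero`), cites the tree's `FK.not_conjectureCOn_fin_ten` / `FK.not_conjectureC` (same statements,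
already landed — not re-derived), and adds docstrings. Framing (director-frontier g15/g16): «FRONTIER rung F-BS / FBP₀; decides the lane's own all-matroid statement
only; nothing percolation-bearing; typed ≠ proved until the gate accepts.» COMPUTATIONAL (`native_decide` ×2; proposed `--computational`).
builds on p205010 (kernel theorem, internal audit signed; external expert review pending).

`S8P` is the vector matroid over `ZMod 2` (tree `Literature.Combinatorics.Matroid.vectorMatroid`) of the ten columns `t = 1111`, `x_i = e_i`
(`i ≤ 4`), `y_i = t + x_i` (`i ≤ 3`), `x₁' = x₁`, `y₁' = y₁`: the Seymour–Welsh matroid `S₈ = Z₄ ∖ y₄` (Oxley, *Matroid Theory*, §12.2 and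
p. 675) with both elements of the leg `{x₁, y₁}` replaced by parallel pairs. With `Φ x y = 1{t ∈ x}·1{x₄ ∈ y}` (nonnegative elementary-square
increments) one gets `Σ_{x,y} conjCKernel S8P 0 x y · Φ x y = 157424 − 157520 = −96 < 0`, contradicting `FK.sum_mul_nonneg_of_inPairSquareCone`;
hence `¬ InPairSquareCone (conjCKernel S8P 0)` (and `¬ ConjectureCOn (Fin 10)`, which is the tree's `FK.not_conjectureCOn_fin_ten`). Architecture as in the spike files: an explicit independence table
(checked against brute-force linear independence over `ZMod 2` by `native_decide`), the kernel at level `0` read off the table, the sum evaluated by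
`native_decide`; everything else is kernel-checked logic.

## References

* J. Oxley, *Matroid Theory*, 2nd ed., OUP (2011), §12.2 (the matroid `S₈`), p. 675, §1.3 (nullity). [Oxley2011]
* D. G. Wagner, *Negatively correlated random variables and Mason's conjecture*, arXiv:math/0602648 (2006), Thm. 5.8(d), §5.3. [Wagner2006]
-/

namespace Summit.CriticalPhenomena.PercolationContinuityZ3.Theorems.FK.S8ParCex

open Literature.Combinatorics.Matroid Finset
open Summit.CriticalPhenomena.PercolationContinuityZ3.Theorems.FK

/-- The ten columns of `S8P` over `ZMod 2` (index 0 = tip `t`, 1‥4 = `x₁‥x₄`, 5‥7 = `y₁‥y₃`, 8 = `x₁'`, 9 = `y₁'`). [cite: Oxley2011, §12.2] -/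
def s8pcol : Fin 10 → Fin 4 → ZMod 2 :=
  ![![1, 1, 1, 1],
    ![1, 0, 0, 0],
    ![0, 1, 0, 0],
    ![0, 0, 1, 0],
    ![0, 0, 0, 1],
    ![0, 1, 1, 1],
    ![1, 0, 1, 1],
    ![1, 1, 0, 1],
    ![1, 0, 0, 0],
    ![0, 1, 1, 1]]

/-- The independence table of `S8P`: entry `enc F` is `true` iff the columns indexed by `F ⊆ Fin 10` are linearly independent over `ZMod 2`
(1024 entries; certified against brute force by `indepB_eq_indepBF`). [cite: Oxley2011, §12.2] -/
def indepTab : Array Bool := #[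
  true, true, true, true, true, true, true, true, true, true, true, true, true, true, true, true, true, true, true, true, true, true, true, true, true, true, true, true, true, true, true, false,
  true, true, true, false, true, true, true, false, true, true, true, false, true, true, true, false, true, true, true, false, true, true, true, false, true, true, true, false, false, false, false, false,
  true, true, true, true, true, false, true, false, true, true, true, true, true, false, true, false, true, true, true, true, true, false, true, false, true, true, false, false, true, false, false, false,
  true, true, true, false, true, false, false, false, true, true, true, false, true, false, false, false, true, true, true, false, true, false, false, false, true, false, false, false, false, false, false, false,
  true, true, true, true, true, true, true, true, true, false, true, false, true, false, true, false, true, true, true, true, true, true, false, false, true, false, true, false, true, false, false, false,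
  true, true, true, false, true, true, true, false, true, false, false, false, true, false, false, false, true, true, true, false, true, false, false, false, true, false, false, false, false, false, false, false,
  true, true, true, true, true, false, true, false, true, false, true, false, false, false, false, false, true, true, true, false, true, false, false, false, true, false, false, false, false, false, false, false,
  true, true, true, false, true, false, false, false, true, false, false, false, false, false, false, false, false, false, false, false, false, false, false, false, false, false, false, false, false, false, false, false,
  true, true, false, false, true, true, false, false, true, true, false, false, true, true, false, false, true, true, false, false, true, true, false, false, true, true, false, false, true, false, false, false,
  true, false, false, false, true, false, false, false, true, false, false, false, true, false, false, false, true, false, false, false, true, false, false, false, true, false, false, false, false, false, false, false,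
  true, true, false, false, true, false, false, false, true, true, false, false, true, false, false, false, true, true, false, false, true, false, false, false, false, false, false, false, false, false, false, false,
  true, false, false, false, false, false, false, false, true, false, false, false, false, false, false, false, true, false, false, false, false, false, false, false, false, false, false, false, false, false, false, false,
  true, true, false, false, true, true, false, false, true, false, false, false, true, false, false, false, true, true, false, false, false, false, false, false, true, false, false, false, false, false, false, false,
  true, false, false, false, true, false, false, false, false, false, false, false, false, false, false, false, true, false, false, false, false, false, false, false, false, false, false, false, false, false, false, false,
  true, true, false, false, true, false, false, false, true, false, false, false, false, false, false, false, true, false, false, false, false, false, false, false, false, false, false, false, false, false, false, false,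
  true, false, false, false, false, false, false, false, false, false, false, false, false, false, false, false, false, false, false, false, false, false, false, false, false, false, false, false, false, false, false, false,
  true, true, true, false, true, true, true, false, true, true, true, false, true, true, true, false, true, true, true, false, true, true, true, false, true, true, true, false, false, false, false, false,
  false, false, false, false, false, false, false, false, false, false, false, false, false, false, false, false, false, false, false, false, false, false, false, false, false, false, false, false, false, false, false, false,
  true, true, true, false, true, false, false, false, true, true, true, false, true, false, false, false, true, true, true, false, true, false, false, false, true, false, false, false, false, false, false, false,
  false, false, false, false, false, false, false, false, false, false, false, false, false, false, false, false, false, false, false, false, false, false, false, false, false, false, false, false, false, false, false, false,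
  true, true, true, false, true, true, true, false, true, false, false, false, true, false, false, false, true, true, true, false, true, false, false, false, true, false, false, false, false, false, false, false,
  false, false, false, false, false, false, false, false, false, false, false, false, false, false, false, false, false, false, false, false, false, false, false, false, false, false, false, false, false, false, false, false,
  true, true, true, false, true, false, false, false, true, false, false, false, false, false, false, false, false, false, false, false, false, false, false, false, false, false, false, false, false, false, false, false,
  false, false, false, false, false, false, false, false, false, false, false, false, false, false, false, false, false, false, false, false, false, false, false, false, false, false, false, false, false, false, false, false,
  true, false, false, false, true, false, false, false, true, false, false, false, true, false, false, false, true, false, false, false, true, false, false, false, true, false, false, false, false, false, false, false,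
  false, false, false, false, false, false, false, false, false, false, false, false, false, false, false, false, false, false, false, false, false, false, false, false, false, false, false, false, false, false, false, false,
  true, false, false, false, false, false, false, false, true, false, false, false, false, false, false, false, true, false, false, false, false, false, false, false, false, false, false, false, false, false, false, false,
  false, false, false, false, false, false, false, false, false, false, false, false, false, false, false, false, false, false, false, false, false, false, false, false, false, false, false, false, false, false, false, false,
  true, false, false, false, true, false, false, false, false, false, false, false, false, false, false, false, true, false, false, false, false, false, false, false, false, false, false, false, false, false, false, false,
  false, false, false, false, false, false, false, false, false, false, false, false, false, false, false, false, false, false, false, false, false, false, false, false, false, false, false, false, false, false, false, false,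
  true, false, false, false, false, false, false, false, false, false, false, false, false, false, false, false, false, false, false, false, false, false, false, false, false, false, false, false, false, false, false, false,
  false, false, false, false, false, false, false, false, false, false, false, false, false, false, false, false, false, false, false, false, false, false, false, false, false, false, false, false, false, false, false, false]


/-- **`S8P := M[t x₁ … x₄ y₁ y₂ y₃ x₁' y₁']` over `GF(2)`**, ground set everything: `S₈ = Z₄∖y₄` with the leg `{x₁,y₁}` doubled.
[cite: Oxley2011, §12.2 and p. 675] -/
noncomputable def S8P : Matroid (Fin 10) := vectorMatroid (ZMod 2) s8pcol Set.univ

/-- Bitmask encoding of a subset of `Fin 10`. [folklore] -/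
def enc (x : Finset (Fin 10)) : ℕ := ∑ i ∈ x, 2 ^ (i : ℕ)

/-- Table lookup: is `x` independent in `S8P`? [cite: Oxley2011, §12.2] -/
def indepB (x : Finset (Fin 10)) : Bool := indepTab.getD (enc x) false

/-- Brute-force test of linear independence of the columns indexed by `F` over `ZMod 2` (all `2⁴`-valued coefficient vectors on `Fin 10`).
[cite: Oxley2011, §1.1 Prop. 1.1.1] -/
def indepBF (F : Finset (Fin 10)) : Bool :=
  decide (∀ g : Fin 10 → ZMod 2, ∑ i ∈ F, g i • s8pcol i = 0 → ∀ i ∈ F, g i = 0)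

/-- **The table is correct** (1024 sets × 1024 coefficient vectors, by evaluation). [cite: Oxley2011, §12.2] -/
theorem indepB_eq_indepBF : ∀ F : Finset (Fin 10), indepB F = indepBF F := by
  native_decide

/-- Independence in `S8P` is the table. [cite: Oxley2011, §1.1 Prop. 1.1.1] -/
theorem indep_iff_indepB (F : Finset (Fin 10)) : S8P.Indep (F : Set (Fin 10)) ↔ indepB F = true := by
  unfold S8P
  rw [vectorMatroid_indep_iff, indepB_eq_indepBF F, indepBF, decide_eq_true_iff,
    linearIndepOn_finset_iff]
  simp

/-- Nullity zero is independence, read off the table. [cite: Oxley2011, §1.3] -/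
theorem corank_eq_zero_iff (F : Finset (Fin 10)) : corank S8P F = 0 ↔ indepB F = true := by
  rw [← indep_iff_indepB, corank, Matroid.indep_iff_eRk_eq_encard_of_finite (F.finite_toSet)]
  have hle := eRk_toNat_le_card S8P F
  have hfin : S8P.eRk (F : Set (Fin 10)) ≠ ⊤ :=
    ne_top_of_le_ne_top (ENat.coe_ne_top (F.card)) (by
      simpa [Set.encard_coe_eq_coe_finsetCard] using S8P.eRk_le_encard (F : Set (Fin 10)))
  rw [Set.encard_coe_eq_coe_finsetCard, Nat.sub_eq_zero_iff_le]
  constructor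
  · intro h
    have : (S8P.eRk (F : Set (Fin 10))).toNat = F.card := le_antisymm hle h
    rw [← this, ENat.coe_toNat hfin]
  · intro h
    have : (S8P.eRk (F : Set (Fin 10))).toNat = F.card := by
      rw [h]; exact ENat.toNat_coe _
    exact this.ge

/-- Integer version of the kernel `conjCKernel S8P 0` read off the table. [cite: Oxley2011, §1.3] -/
def KZ (x y : Finset (Fin 10)) : ℤ :=
  (if indepB (x \ y) && indepB (y \ x) then 1 else 0) -
  (if indepB (x ∩ y) && indepB (xᶜ ∩ yᶜ) then 1 else 0)

/-- The test function `Φ x y = 1{t ∈ x} 1{x₄ ∈ y}` (integer version). [cite: Wagner2006, Thm. 5.8(d), §5.3] -/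
def PhiZ (x y : Finset (Fin 10)) : ℤ := if (0 : Fin 10) ∈ x ∧ (4 : Fin 10) ∈ y then 1 else 0

/-- **THE COMPUTATION: `Σ K₀ Φ = −96`** (157424 twisted − 157520 aligned). [cite: Oxley2011, §12.2] -/
theorem sum_KZ_PhiZ : (∑ x : Finset (Fin 10), ∑ y : Finset (Fin 10), KZ x y * PhiZ x y) = -96 := by
  native_decide

/-- The `DecidableEq` instance baked into `conjCKernel` (classical, from the defs file) is the computable one up to `Subsingleton.elim`. [folklore] -/
theorem decEq_classical_eq :
    (fun a b => Classical.propDecidable (a = b) : DecidableEq (Fin 10)) = instDecidableEqFin 10 :=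
  Subsingleton.elim _ _

/-- The level-`0` kernel of `S8P` is the tabulated `KZ`. [cite: Oxley2011, §1.3] -/
theorem conjCKernel_eq (x y : Finset (Fin 10)) : conjCKernel S8P 0 x y = (KZ x y : ℝ) := by
  have hc : ∀ F : Finset (Fin 10), corank S8P F = 0 ↔ indepB F = true := corank_eq_zero_iff
  unfold conjCKernel twistedNullLevel alignedNullLevel
  rw [decEq_classical_eq]
  simp only [Nat.le_zero, Nat.add_eq_zero_iff, hc, KZ, ← Bool.and_eq_true]
  push_cast
  rfl

/-- The real test function `Φ = 1{t ∈ x} 1{x₄ ∈ y}`. [cite: Wagner2006, Thm. 5.8(d), §5.3] -/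
noncomputable def Phi (x y : Finset (Fin 10)) : ℝ := (PhiZ x y : ℝ)

/-- `Φ` as a product of indicators. [cite: Wagner2006, Thm. 5.8(d), §5.3] -/
theorem Phi_eq (x y : Finset (Fin 10)) :
    Phi x y = (if (0 : Fin 10) ∈ x then (1 : ℝ) else 0) * (if (4 : Fin 10) ∈ y then 1 else 0) := by
  unfold Phi PhiZ
  by_cases h0 : (0 : Fin 10) ∈ x <;> by_cases h5 : (4 : Fin 10) ∈ y <;> simp [h0, h5]

/-- `1{e ∈ s} ≤ 1{e ∈ t}` for `s ⊆ t`. [folklore] -/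
theorem indicator_mono {s t : Finset (Fin 10)} (e : Fin 10) (hst : s ⊆ t) :
    (if e ∈ s then (1 : ℝ) else 0) ≤ (if e ∈ t then 1 else 0) := by
  by_cases h : e ∈ s
  · rw [if_pos h, if_pos (hst h)]
  · rw [if_neg h]; split_ifs <;> norm_num

/-- `Φ` has nonnegative elementary-square increments (a product of two nonnegative differences). [cite: Wagner2006, Thm. 5.8(d), §5.3] -/
theorem Phi_square_nonneg (x y : Finset (Fin 10)) (a b : Fin 10) :
    0 ≤ Phi x y + Phi (insert a x) (insert b y) - Phi (insert a x) y - Phi x (insert b y) := by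
  simp only [Phi_eq]
  have key : ∀ f1 f2 g1 g2 : ℝ, f1 * g1 + f2 * g2 - f2 * g1 - f1 * g2 = (f2 - f1) * (g2 - g1) := by
    intros; ring
  rw [key]
  exact mul_nonneg (sub_nonneg.mpr (indicator_mono 0 (Finset.subset_insert a x)))
    (sub_nonneg.mpr (indicator_mono 4 (Finset.subset_insert b y)))

/-- **`Σ_{x,y} conjCKernel S8P 0 x y · Φ x y = −96`**. [cite: Oxley2011, §12.2] -/
theorem sum_conjCKernel_Phi :
    (∑ x : Finset (Fin 10), ∑ y : Finset (Fin 10), conjCKernel S8P 0 x y * Phi x y) = -96 := by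
  have h : (∑ x : Finset (Fin 10), ∑ y : Finset (Fin 10), conjCKernel S8P 0 x y * Phi x y)
      = ((∑ x : Finset (Fin 10), ∑ y : Finset (Fin 10), KZ x y * PhiZ x y : ℤ) : ℝ) := by
    push_cast
    refine Finset.sum_congr rfl fun x _ => Finset.sum_congr rfl fun y _ => ?_
    rw [conjCKernel_eq, Phi]
  rw [h, sum_KZ_PhiZ]; norm_num

/-- **`K₀(S8P)` IS NOT IN THE PAIR-SQUARE CONE**: `(ID)_0` fails for `S₈⁺` although it holds for `S₈` — membership is not preserved by parallel
extension. [cite: Oxley2011, §12.2] [cite: Wagner2006, Thm. 5.8(d), §5.3] -/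
theorem not_inPairSquareCone_conjCKernel_S8par_zero : ¬ InPairSquareCone (conjCKernel S8P 0) := by
  intro hK
  have hΦ := Phi_square_nonneg
  rw [← decEq_classical_eq] at hΦ
  have h := sum_mul_nonneg_of_inPairSquareCone hK Phi hΦ
  rw [sum_conjCKernel_Phi] at h
  norm_num at h

end Summit.CriticalPhenomena.PercolationContinuityZ3.Theorems.FK.S8ParCex
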